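import Mathlib.Analysis.Normed.Group.Basic
import Mathlib.Algebra.Order.Chebyshev
import Literature.MathematicalPhysics.QuantumFieldTheory.Balaban1983to89.B4Eq19LatticeOperators
import HarnessLib

/-!
# LINE 25 «CompactnessTransfer» (crux `HistoryTailL` stmt-QuantumFields-19936 ∕ K2 crux `BlockLipschitzL` stmt-QuantumFields-23533), S2′ infrastructure (Γ1),
# FILE M1: LATTICE TRANSLATIONS ARE CONTROLLED BY THE BOND ENERGY — for `u : ℤ³ → V` and a lattice vector `w`,
# `Σ_{a ∈ A, a − w ∈ A} ‖u a − u (a − w)‖² ≤ 3·(Σ_j w_j²)·Σ_{p ∈ A} Σ_μ ‖u(p + e_μ) − u p‖²` on every lattice cube `A = [lo, hi]³`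

Cell `ym3-torus` (YM ladder rung R3 = continuum SU(2) Yang–Mills on the three-torus — a RUNG, NOT the Clay problem: not d = 4, not infinite volume, not a mass gap);
width seat `ym3-torus-px3` gen 7, the Γ1 seat (LEAD ym-ust-19936-w1 g9 11:10:54Z GO ∕ 11:21:00Z cut; ★★OWNER g30 «cite, don't restate»; road of record 11:24Z:
(c3) of SIGNATURE-0 `blowDown_L2_compact` BY NAME through lit ✓`Literature.Analysis.FunctionSpaces.exists_finset_eLpNorm_sub_lt_of_translate` (Kolmogorov–M. Riesz–Fréchet
sufficiency), which asks for the `L²`-TRANSLATION MODULUS of the piecewise-constant blow-downs; this file is its lattice half).  THEOREMS ONLY (def-free); `--supports` the K2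
crux as a helper.  Nothing here proves Γ1, S2′, the organ, `BlockLipschitzL`, `HistoryTailL` or any summit statement.

WHY.  Translating the blow-down `x ↦ u(z + ⌊R·x⌋)` by `y` moves the lattice index by a vector `w` with `|wᵢ − R yᵢ| < 1`; the value difference `u(a) − u(a − w)`
is telescoped along the coordinate path `a − w → a` (first coordinate 0, then 1, then 2): `‖u a − u (a − w)‖² ≤ 3 Σ_j |w_j| Σ_{bonds of leg j} ‖δ_j u‖²` (Cauchy–Schwarz per
leg), and summing over the cube each `j`-bond is the `t`-th bond of leg `j` for at most `|w_j|` starting points `a` (the re-indexing `a ↦ bond` is injective at fixed `t`),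
whence the factor `w_j²` and the TOTAL energy on the right (LEAD's 11:10:54Z letter (a) «`Σ‖u(y + h e_μ) − u y‖² ≤ h²·Σ‖δu‖²`», with mixed directions).
* §1 one leg: `norm_sub_update_add_le_range_sum` (telescoping), `norm_sub_update_le_range_sum` (either orientation, `|p − q|` bonds from `min p q`),
  `norm_sub_update_sq_le_range_sum` (Cauchy–Schwarz: `≤ |p − q| · Σ ‖δ‖²`).
* §2 the three-leg path on `ℤ³`: `norm_sub_sq_le_three_legs`.
* §3 counting on the cube `A = Π [lo, hi]`, `A_w = {a ∈ A : a − w ∈ A} = Π [max lo (lo + wᵢ), min hi (hi + wᵢ)]`: `leg_point_mem`, `leg_point_injective`,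
  `sum_leg_le`, ★★ `sum_norm_sub_translate_sq_le` (the display above).
[folklore] ([AlicandroCicalese2008] §2 (difference quotients of lattice spin fields); [Adams1975] Thm 2.21 (the translation condition); statements and proofs are this file's).
-/

set_option autoImplicit false

noncomputable section

open scoped BigOperators
open Finset

namespace Summit.QuantumFields.YangMills.Theorems.PoincareLipschitzLatticeTranslationPaths

open Literature.MathematicalPhysics.QuantumFieldTheory.Balaban1983to89
open B4Eq19LatticeOperators

variable {d : ℕ} {V : Type*} [NormedAddCommGroup V]

/-! ## §1 One leg: a coordinate segment -/

/-- **Telescoping along a coordinate segment**: `‖v(x[j := c + m]) − v(x[j := c])‖ ≤ Σ_{t < m} ‖v(x[j := c+t] + e_j) − v(x[j := c+t])‖`.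
[folklore] [cite: Giaquinta1984, Ch. III §1 p.65] -/
theorem norm_sub_update_add_le_range_sum (v : Zd d → V) (x : Zd d) (j : Fin d) (c : ℤ) (m : ℕ) :
    ‖v (Function.update x j (c + m)) - v (Function.update x j c)‖ ≤
      ∑ t ∈ Finset.range m, ‖v (Function.update x j (c + t) + unitVec j) - v (Function.update x j (c + t))‖ := by
  induction m with
  | zero => simp
  | succ m ih =>
    have hup : Function.update x j (c + m) + unitVec j = Function.update x j (c + ((m + 1 : ℕ) : ℤ)) := by
      funext i
      by_cases hi : i = j
      · subst hi; simp; ring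
      · simp [Function.update_of_ne hi, unitVec_apply_ne hi]
    rw [Finset.sum_range_succ]
    calc ‖v (Function.update x j (c + ((m + 1 : ℕ) : ℤ))) - v (Function.update x j c)‖
        = ‖(v (Function.update x j (c + ((m + 1 : ℕ) : ℤ))) - v (Function.update x j (c + m)))
            + (v (Function.update x j (c + m)) - v (Function.update x j c))‖ := by rw [sub_add_sub_cancel]
      _ ≤ ‖v (Function.update x j (c + ((m + 1 : ℕ) : ℤ))) - v (Function.update x j (c + m))‖
            + ‖v (Function.update x j (c + m)) - v (Function.update x j c)‖ := norm_add_le _ _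
      _ ≤ ‖v (Function.update x j (c + (m : ℕ)) + unitVec j) - v (Function.update x j (c + (m : ℕ)))‖
            + ∑ t ∈ Finset.range m, ‖v (Function.update x j (c + t) + unitVec j) - v (Function.update x j (c + t))‖ := by
          rw [← hup]
          exact add_le_add le_rfl ih
      _ = _ := add_comm _ _

/-- **One leg, either orientation**: `‖v(x[j := p]) − v(x[j := q])‖ ≤ Σ_{t < |p − q|} ‖v(x[j := s+t] + e_j) − v(x[j := s+t])‖`, `s = min p q`.
[folklore] [cite: Giaquinta1984, Ch. III §1 p.65] -/
theorem norm_sub_update_le_range_sum (v : Zd d → V) (x : Zd d) (j : Fin d) (p q : ℤ) :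
    ‖v (Function.update x j p) - v (Function.update x j q)‖ ≤
      ∑ t ∈ Finset.range (p - q).natAbs, ‖v (Function.update x j (min p q + t) + unitVec j) - v (Function.update x j (min p q + t))‖ := by
  rcases le_total q p with h | h
  · have hm : ((p - q).natAbs : ℤ) = p - q := Int.natAbs_of_nonneg (by linarith)
    have hmin : min p q = q := min_eq_right h
    have hp : p = min p q + ((p - q).natAbs : ℕ) := by rw [hmin, hm]; ring
    conv_lhs => rw [hp, hmin]
    rw [hmin]
    exact norm_sub_update_add_le_range_sum v x j q _
  · have hm : ((p - q).natAbs : ℤ) = q - p := by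
      rw [Int.ofNat_natAbs_of_nonpos (by linarith)]; ring
    have hmin : min p q = p := min_eq_left h
    have hq : q = min p q + ((p - q).natAbs : ℕ) := by rw [hmin, hm]; ring
    rw [norm_sub_rev]
    conv_lhs => rw [hq, hmin]
    rw [hmin]
    exact norm_sub_update_add_le_range_sum v x j p _

/-- **One leg, squared (Cauchy–Schwarz)**: `‖v(x[j := p]) − v(x[j := q])‖² ≤ |p − q| · Σ_{t < |p − q|} ‖v(x[j := s+t] + e_j) − v(x[j := s+t])‖²`, `s = min p q`.
[folklore] [cite: Giaquinta1984, Ch. III §1 p.65] -/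
theorem norm_sub_update_sq_le_range_sum (v : Zd d → V) (x : Zd d) (j : Fin d) (p q : ℤ) :
    ‖v (Function.update x j p) - v (Function.update x j q)‖ ^ 2 ≤
      ((p - q).natAbs : ℝ) * ∑ t ∈ Finset.range (p - q).natAbs,
        ‖v (Function.update x j (min p q + t) + unitVec j) - v (Function.update x j (min p q + t))‖ ^ 2 := by
  have h1 := norm_sub_update_le_range_sum v x j p q
  have h2 := pow_le_pow_left₀ (norm_nonneg _) h1 2
  refine h2.trans ?_
  have h3 := @sq_sum_le_card_mul_sum_sq _ ℝ _ _ _ _ (Finset.range (p - q).natAbs)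
    (fun t => ‖v (Function.update x j (min p q + t) + unitVec j) - v (Function.update x j (min p q + t))‖)
  rw [Finset.card_range] at h3
  exact h3

/-! ## §2 The three-leg path on `ℤ³` -/

/-- `‖x + y + z‖² ≤ 3(‖x‖² + ‖y‖² + ‖z‖²)`-type bound for a three-step telescoping. [folklore] -/
theorem norm_sub_sq_le_three (p₀ p₁ p₂ p₃ : V) :
    ‖p₃ - p₀‖ ^ 2 ≤ 3 * (‖p₁ - p₀‖ ^ 2 + ‖p₂ - p₁‖ ^ 2 + ‖p₃ - p₂‖ ^ 2) := by
  have h : ‖p₃ - p₀‖ ≤ ‖p₁ - p₀‖ + ‖p₂ - p₁‖ + ‖p₃ - p₂‖ := by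
    have e : p₃ - p₀ = (p₁ - p₀) + (p₂ - p₁) + (p₃ - p₂) := by abel
    rw [e]
    exact (norm_add_le _ _).trans (add_le_add (norm_add_le _ _) le_rfl)
  have h0 : 0 ≤ ‖p₃ - p₀‖ := norm_nonneg _
  nlinarith [sq_nonneg (‖p₁ - p₀‖ - ‖p₂ - p₁‖), sq_nonneg (‖p₂ - p₁‖ - ‖p₃ - p₂‖), sq_nonneg (‖p₁ - p₀‖ - ‖p₃ - p₂‖),
    norm_nonneg (p₁ - p₀), norm_nonneg (p₂ - p₁), norm_nonneg (p₃ - p₂)]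

/-- The `j`-th vertex of the coordinate path from `a − w` to `a`: coordinates `< j` already moved to `a`, coordinates `≥ j` still at `a − w`; written as the explicit
lambda `fun i => if (i : ℕ) < j then a i else a i − w i`.  `vertex 0 = a − w`, `vertex 3 = a`, `vertex (j+1) = (vertex j)[j := a j]`. [folklore] -/
theorem path_vertex_zero (a w : Zd 3) : (fun i : Fin 3 => if (i : ℕ) < 0 then a i else a i - w i) = a - w := by
  funext i; simp

/-- See `path_vertex_zero`. [folklore] -/
theorem path_vertex_three (a w : Zd 3) : (fun i : Fin 3 => if (i : ℕ) < 3 then a i else a i - w i) = a := by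
  funext i; simp [i.isLt]

/-- See `path_vertex_zero`: `vertex (j+1) = (vertex j)[j := a j]`. [folklore] -/
theorem path_vertex_succ (a w : Zd 3) (j : Fin 3) :
    (fun i : Fin 3 => if (i : ℕ) < (j : ℕ) + 1 then a i else a i - w i)
      = Function.update (fun i : Fin 3 => if (i : ℕ) < (j : ℕ) then a i else a i - w i) j (a j) := by
  funext i
  by_cases hij : i = j
  · subst hij; simp
  · rw [Function.update_of_ne hij]
    have hne : (i : ℕ) ≠ (j : ℕ) := fun h => hij (Fin.ext h)
    by_cases h1 : (i : ℕ) < (j : ℕ)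
    · simp [h1, show (i : ℕ) < (j : ℕ) + 1 by omega]
    · simp [h1, show ¬ (i : ℕ) < (j : ℕ) + 1 by omega]

/-- The `j`-th vertex has `j`-th coordinate `a j − w j`. [folklore] -/
theorem path_vertex_update_self (a w : Zd 3) (j : Fin 3) :
    Function.update (fun i : Fin 3 => if (i : ℕ) < (j : ℕ) then a i else a i - w i) j (a j - w j)
      = (fun i : Fin 3 => if (i : ℕ) < (j : ℕ) then a i else a i - w i) := by
  funext i
  by_cases hij : i = j
  · subst hij; simp
  · rw [Function.update_of_ne hij]

/-- ★ **THE THREE-LEG PATH BOUND**: for `u : ℤ³ → V` and `a w ∈ ℤ³`,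
`‖u a − u (a − w)‖² ≤ 3 · Σ_j |w_j| · Σ_{t < |w_j|} ‖u(q_j(t) + e_j) − u(q_j(t))‖²`, where the `t`-th bond of leg `j` sits at
`q_j(t) = (vertex j)[j := min (a j) (a j − w j) + t]`. [folklore] [cite: AlicandroCicalese2008, §2] -/
theorem norm_sub_sq_le_three_legs (u : Zd 3 → V) (a w : Zd 3) :
    ‖u a - u (a - w)‖ ^ 2 ≤ 3 * ∑ j : Fin 3, ((w j).natAbs : ℝ) * ∑ t ∈ Finset.range (w j).natAbs,
      ‖u (Function.update (fun i : Fin 3 => if (i : ℕ) < (j : ℕ) then a i else a i - w i) j (min (a j) (a j - w j) + t) + unitVec j)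
        - u (Function.update (fun i : Fin 3 => if (i : ℕ) < (j : ℕ) then a i else a i - w i) j (min (a j) (a j - w j) + t))‖ ^ 2 := by
  -- the vertices `V n = (a on coordinates < n, a − w on the rest)`
  let V : ℕ → Zd 3 := fun n => fun i : Fin 3 => if (i : ℕ) < n then a i else a i - w i
  have hV0 : V 0 = a - w := path_vertex_zero a w
  have hV3 : V 3 = a := path_vertex_three a w
  show ‖u a - u (a - w)‖ ^ 2 ≤ 3 * ∑ j : Fin 3, ((w j).natAbs : ℝ) * ∑ t ∈ Finset.range (w j).natAbs,
      ‖u (Function.update (V j) j (min (a j) (a j - w j) + t) + unitVec j) - u (Function.update (V j) j (min (a j) (a j - w j) + t))‖ ^ 2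
  -- each leg
  have hleg : ∀ j : Fin 3, ‖u (V ((j : ℕ) + 1)) - u (V j)‖ ^ 2 ≤ ((w j).natAbs : ℝ) * ∑ t ∈ Finset.range (w j).natAbs,
      ‖u (Function.update (V j) j (min (a j) (a j - w j) + t) + unitVec j) - u (Function.update (V j) j (min (a j) (a j - w j) + t))‖ ^ 2 := by
    intro j
    have e1 : V ((j : ℕ) + 1) = Function.update (V j) j (a j) := path_vertex_succ a w j
    have e2 : V j = Function.update (V j) j (a j - w j) := (path_vertex_update_self a w j).symm
    have key := norm_sub_update_sq_le_range_sum u (V j) j (a j) (a j - w j)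
    rw [show a j - (a j - w j) = w j by ring] at key
    rw [e1]
    calc ‖u (Function.update (V j) j (a j)) - u (V j)‖ ^ 2
        = ‖u (Function.update (V j) j (a j)) - u (Function.update (V j) j (a j - w j))‖ ^ 2 := by rw [← e2]
      _ ≤ _ := key
  have hsum : ‖u (V 3) - u (V 0)‖ ^ 2 ≤ 3 * (‖u (V 1) - u (V 0)‖ ^ 2 + ‖u (V 2) - u (V 1)‖ ^ 2 + ‖u (V 3) - u (V 2)‖ ^ 2) :=
    norm_sub_sq_le_three _ _ _ _
  have hrew : u a - u (a - w) = u (V 3) - u (V 0) := by rw [hV3, hV0]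
  rw [hrew, Fin.sum_univ_three]
  have h0' := hleg 0
  have h1' := hleg 1
  have h2' := hleg 2
  simp only [Fin.val_zero, Fin.val_one, Fin.val_two, Nat.reduceAdd, zero_add] at h0' h1' h2' ⊢
  linarith [h0', h1', h2', hsum]

/-! ## §3 Counting on a cube -/

/-- For `a ∈ A_w = Π_i [max lo (lo + wᵢ), min hi (hi + wᵢ)]` and `t < |w_j|`, the bond point `q_j(t)` lies in the cube `A = Π_i [lo, hi]`. [folklore] -/
theorem leg_point_mem (lo hi : ℤ) (a w : Zd 3) (ha : a ∈ Fintype.piFinset fun i : Fin 3 => Finset.Icc (max lo (lo + w i)) (min hi (hi + w i)))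
    (j : Fin 3) {t : ℕ} (ht : t < (w j).natAbs) :
    Function.update (fun i : Fin 3 => if (i : ℕ) < (j : ℕ) then a i else a i - w i) j (min (a j) (a j - w j) + t)
      ∈ Fintype.piFinset fun _ : Fin 3 => Finset.Icc lo hi := by
  rw [Fintype.mem_piFinset] at ha ⊢
  intro i
  have hai := ha i
  rw [Finset.mem_Icc, max_le_iff, le_min_iff] at hai
  rw [Finset.mem_Icc]
  by_cases hij : i = j
  · subst hij
    rw [Function.update_self]
    have ht' : (t : ℤ) < (w i).natAbs := by exact_mod_cast ht
    rcases le_total 0 (w i) with hw | hw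
    · rw [Int.natAbs_of_nonneg hw] at ht'
      rw [min_eq_right (by linarith)]
      constructor <;> linarith [hai.1.1, hai.1.2, hai.2.1, hai.2.2]
    · have : ((w i).natAbs : ℤ) = - w i := by rw [Int.ofNat_natAbs_of_nonpos hw]
      rw [this] at ht'
      rw [min_eq_left (by linarith)]
      constructor <;> linarith [hai.1.1, hai.1.2, hai.2.1, hai.2.2]
  · rw [Function.update_of_ne hij]
    by_cases h1 : (i : ℕ) < (j : ℕ)
    · simp only [h1, if_true]; constructor <;> linarith [hai.1.1, hai.2.1]
    · simp only [h1, if_false]; constructor <;> linarith [hai.1.2, hai.2.2]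

/-- At fixed `j, t, w`, the bond point `q_j(t)` determines the starting point `a`: the re-indexing is injective. [folklore] -/
theorem leg_point_injective (w : Zd 3) (j : Fin 3) (t : ℕ) :
    Function.Injective fun a : Zd 3 =>
      Function.update (fun i : Fin 3 => if (i : ℕ) < (j : ℕ) then a i else a i - w i) j (min (a j) (a j - w j) + t) := by
  intro a a' h
  have hc : ∀ i, Function.update (fun i : Fin 3 => if (i : ℕ) < (j : ℕ) then a i else a i - w i) j (min (a j) (a j - w j) + t) i
      = Function.update (fun i : Fin 3 => if (i : ℕ) < (j : ℕ) then a' i else a' i - w i) j (min (a' j) (a' j - w j) + t) i :=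
    fun i => congrFun h i
  funext i
  by_cases hij : i = j
  · subst hij
    have := hc i
    simp only [Function.update_self] at this
    -- `min (a i) (a i − w i) = a i − max (w i) 0`
    rcases le_total 0 (w i) with hw | hw
    · rw [min_eq_right (by linarith), min_eq_right (by linarith)] at this; linarith
    · rw [min_eq_left (by linarith), min_eq_left (by linarith)] at this; linarith
  · have := hc i
    rw [Function.update_of_ne hij, Function.update_of_ne hij] at this
    by_cases h1 : (i : ℕ) < (j : ℕ)
    · simpa [h1] using this
    · simp only [h1, if_false] at this; linarith

/-- ★ **Counting one leg over the cube**: for `g ≥ 0` on `ℤ³`,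
`Σ_{a ∈ A_w} Σ_{t < |w_j|} g(q_j(a, t)) ≤ |w_j| · Σ_{p ∈ A} g p`. [folklore] [cite: AlicandroCicalese2008, §2] -/
theorem sum_leg_le (lo hi : ℤ) (w : Zd 3) (j : Fin 3) (g : Zd 3 → ℝ) (hg : ∀ p, 0 ≤ g p) :
    ∑ a ∈ Fintype.piFinset (fun i : Fin 3 => Finset.Icc (max lo (lo + w i)) (min hi (hi + w i))),
        ∑ t ∈ Finset.range (w j).natAbs,
          g (Function.update (fun i : Fin 3 => if (i : ℕ) < (j : ℕ) then a i else a i - w i) j (min (a j) (a j - w j) + t))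
      ≤ ((w j).natAbs : ℝ) * ∑ p ∈ Fintype.piFinset (fun _ : Fin 3 => Finset.Icc lo hi), g p := by
  classical
  rw [Finset.sum_comm]
  have hterm : ∀ t ∈ Finset.range (w j).natAbs,
      ∑ a ∈ Fintype.piFinset (fun i : Fin 3 => Finset.Icc (max lo (lo + w i)) (min hi (hi + w i))),
          g (Function.update (fun i : Fin 3 => if (i : ℕ) < (j : ℕ) then a i else a i - w i) j (min (a j) (a j - w j) + t))
        ≤ ∑ p ∈ Fintype.piFinset (fun _ : Fin 3 => Finset.Icc lo hi), g p := by
    intro t ht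
    rw [Finset.mem_range] at ht
    rw [← Finset.sum_image (f := g) (fun a _ a' _ h => leg_point_injective w j t h)]
    refine Finset.sum_le_sum_of_subset_of_nonneg (fun p hp => ?_) fun _ _ _ => hg _
    rw [Finset.mem_image] at hp
    obtain ⟨a, ha, rfl⟩ := hp
    exact leg_point_mem lo hi a w ha j ht
  calc ∑ t ∈ Finset.range (w j).natAbs, ∑ a ∈ Fintype.piFinset (fun i : Fin 3 => Finset.Icc (max lo (lo + w i)) (min hi (hi + w i))),
          g (Function.update (fun i : Fin 3 => if (i : ℕ) < (j : ℕ) then a i else a i - w i) j (min (a j) (a j - w j) + t))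
      ≤ ∑ t ∈ Finset.range (w j).natAbs, ∑ p ∈ Fintype.piFinset (fun _ : Fin 3 => Finset.Icc lo hi), g p := Finset.sum_le_sum hterm
    _ = ((w j).natAbs : ℝ) * ∑ p ∈ Fintype.piFinset (fun _ : Fin 3 => Finset.Icc lo hi), g p := by
        rw [Finset.sum_const, Finset.card_range, nsmul_eq_mul]

/-- ★★ **LATTICE TRANSLATIONS ARE CONTROLLED BY THE BOND ENERGY**: on the cube `A = [lo, hi]³`, for every lattice vector `w`,
`Σ_{a ∈ A, a − w ∈ A} ‖u a − u (a − w)‖² ≤ 3 · (Σ_j w_j²) · Σ_{p ∈ A} Σ_μ ‖u(p + e_μ) − u p‖²` (`A_w := {a ∈ A : a − w ∈ A} = Π_i [max lo (lo + wᵢ), min hi (hi + wᵢ)]`;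
the energy on the right is the tree's `Σ_Q Σ_μ` convention). [folklore] [cite: AlicandroCicalese2008, §2; Adams1975, Thm 2.21] -/
theorem sum_norm_sub_translate_sq_le (u : Zd 3 → V) (lo hi : ℤ) (w : Zd 3) :
    ∑ a ∈ Fintype.piFinset (fun i : Fin 3 => Finset.Icc (max lo (lo + w i)) (min hi (hi + w i))), ‖u a - u (a - w)‖ ^ 2
      ≤ 3 * (∑ j : Fin 3, ((w j : ℤ) : ℝ) ^ 2) *
          ∑ p ∈ Fintype.piFinset (fun _ : Fin 3 => Finset.Icc lo hi), ∑ μ : Fin 3, ‖u (p + unitVec μ) - u p‖ ^ 2 := by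
  classical
  set Aw := Fintype.piFinset (fun i : Fin 3 => Finset.Icc (max lo (lo + w i)) (min hi (hi + w i))) with hAw
  set A := Fintype.piFinset (fun _ : Fin 3 => Finset.Icc lo hi) with hA
  have hE0 : ∀ μ : Fin 3, 0 ≤ ∑ p ∈ A, ‖u (p + unitVec μ) - u p‖ ^ 2 := fun μ => Finset.sum_nonneg fun _ _ => sq_nonneg _
  -- pointwise three-leg bound, summed
  have h1 : ∑ a ∈ Aw, ‖u a - u (a - w)‖ ^ 2 ≤ ∑ a ∈ Aw, 3 * ∑ j : Fin 3, ((w j).natAbs : ℝ) * ∑ t ∈ Finset.range (w j).natAbs,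
      ‖u (Function.update (fun i : Fin 3 => if (i : ℕ) < (j : ℕ) then a i else a i - w i) j (min (a j) (a j - w j) + t) + unitVec j)
        - u (Function.update (fun i : Fin 3 => if (i : ℕ) < (j : ℕ) then a i else a i - w i) j (min (a j) (a j - w j) + t))‖ ^ 2 :=
    Finset.sum_le_sum fun a _ => norm_sub_sq_le_three_legs u a w
  refine h1.trans ?_
  rw [← Finset.mul_sum, Finset.sum_comm]
  -- per leg
  have h2 : ∀ j : Fin 3, ∑ a ∈ Aw, ((w j).natAbs : ℝ) * ∑ t ∈ Finset.range (w j).natAbs,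
      ‖u (Function.update (fun i : Fin 3 => if (i : ℕ) < (j : ℕ) then a i else a i - w i) j (min (a j) (a j - w j) + t) + unitVec j)
        - u (Function.update (fun i : Fin 3 => if (i : ℕ) < (j : ℕ) then a i else a i - w i) j (min (a j) (a j - w j) + t))‖ ^ 2
      ≤ ((w j : ℤ) : ℝ) ^ 2 * ∑ p ∈ A, ‖u (p + unitVec j) - u p‖ ^ 2 := by
    intro j
    rw [← Finset.mul_sum]
    have hc := sum_leg_le lo hi w j (fun p => ‖u (p + unitVec j) - u p‖ ^ 2) (fun p => sq_nonneg _)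
    rw [← hAw, ← hA] at hc
    have hsq : ((w j).natAbs : ℝ) * ((w j).natAbs : ℝ) = ((w j : ℤ) : ℝ) ^ 2 := by
      rw [Nat.cast_natAbs, Int.cast_abs, abs_mul_abs_self, sq]
    calc ((w j).natAbs : ℝ) * ∑ a ∈ Aw, ∑ t ∈ Finset.range (w j).natAbs,
          ‖u (Function.update (fun i : Fin 3 => if (i : ℕ) < (j : ℕ) then a i else a i - w i) j (min (a j) (a j - w j) + t) + unitVec j)
            - u (Function.update (fun i : Fin 3 => if (i : ℕ) < (j : ℕ) then a i else a i - w i) j (min (a j) (a j - w j) + t))‖ ^ 2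
        ≤ ((w j).natAbs : ℝ) * (((w j).natAbs : ℝ) * ∑ p ∈ A, ‖u (p + unitVec j) - u p‖ ^ 2) :=
          mul_le_mul_of_nonneg_left hc (Nat.cast_nonneg _)
      _ = ((w j : ℤ) : ℝ) ^ 2 * ∑ p ∈ A, ‖u (p + unitVec j) - u p‖ ^ 2 := by rw [← mul_assoc, hsq]
  calc 3 * ∑ j : Fin 3, ∑ a ∈ Aw, ((w j).natAbs : ℝ) * ∑ t ∈ Finset.range (w j).natAbs,
          ‖u (Function.update (fun i : Fin 3 => if (i : ℕ) < (j : ℕ) then a i else a i - w i) j (min (a j) (a j - w j) + t) + unitVec j)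
            - u (Function.update (fun i : Fin 3 => if (i : ℕ) < (j : ℕ) then a i else a i - w i) j (min (a j) (a j - w j) + t))‖ ^ 2
      ≤ 3 * ∑ j : Fin 3, ((w j : ℤ) : ℝ) ^ 2 * ∑ p ∈ A, ‖u (p + unitVec j) - u p‖ ^ 2 := by
        gcongr with j
        exact h2 j
    _ ≤ 3 * ∑ j : Fin 3, ((w j : ℤ) : ℝ) ^ 2 * ∑ p ∈ A, ∑ μ : Fin 3, ‖u (p + unitVec μ) - u p‖ ^ 2 := by
        gcongr with j _ p _
        exact Finset.single_le_sum (f := fun μ => ‖u (p + unitVec μ) - u p‖ ^ 2) (fun _ _ => sq_nonneg _) (Finset.mem_univ j)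
    _ = 3 * (∑ j : Fin 3, ((w j : ℤ) : ℝ) ^ 2) * ∑ p ∈ A, ∑ μ : Fin 3, ‖u (p + unitVec μ) - u p‖ ^ 2 := by
        rw [← Finset.sum_mul]; ring

end Summit.QuantumFields.YangMills.Theorems.PoincareLipschitzLatticeTranslationPaths

end
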